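import Literature.NumberTheory.IwasawaTheory.ClassicalMuVanishesQuadraticAscentRat
import Literature.NumberTheory.IwasawaTheory.ClassicalMuVanishesTwoPowerAscent
import Literature.NumberTheory.IwasawaTheory.ClassicalMuVanishesImaginaryQuadraticTwoProofs
import Literature.NumberTheory.IwasawaTheory.ClassicalMuVanishesNormRelationTower
import Literature.NumberTheory.IwasawaTheory.ClassicalMuVanishesIffBoundedRank
import Literature.NumberTheory.IwasawaTheory.ClassicalMuVanishesBoundedRankProofs
import Literature.NumberTheory.NumberFields.QuadraticRamifiedPrimesBound
import Literature.NumberTheory.EllipticCurves.ZpExtensionRestrictShift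
import HarnessLib

/-!
# Iwasawa's `μ₂ = 0` ascends a quadratic extension `K ⊆ K'` with NO hypothesis on `K ∩ ℚ_∞`, `K' ∩ ℚ_∞`
# (Iwasawa 1973 Thm. 3 at `ℓ = 2`, one step, intrinsic form; proved, no definition, no named fact)

`Proofs`-style file (theorems only, no `sorry`) in topic `NumberTheory/IwasawaTheory` (namespace `Literature.NumberTheory.IwasawaTheory`),
written by the prover seat `bsd-line-att-p3` g36 (cell `bsd-f1-sign2`, route `AlignedTransportAtTwo`, `--supports` stmt-BirchSwinnertonDyer-22298;
closes nothing; nothing about elliptic curves or BSD is asserted).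

All quadratic-step `μ₂`-ascents of the tree (`ClassicalMuVanishesQuadraticAscent{,Rat,Sqrt,Intrinsic}`, `…TwoPowerAscent`) are stated in the
RESTRICTED currency `κ.restrict K hK` — `κ` the cyclotomic `ℤ₂`-extension of `ℚ` and `hK` the surjectivity of `κ ∘ res_K`, i.e. `K ∩ ℚ_∞ = ℚ`
(«`√2 ∉ K`»).  Iwasawa's Theorem 3 has no such proviso: for a finite `M/ℚ` with `M ∩ ℚ_∞ = ℚ_a` the cyclotomic `ℤ₂`-extension of `M` is
`M·ℚ_∞` with `n`-th layer `M·ℚ_{n+a}` (Washington §13.1).  Cell bsd-2adic's `ZpExtensionRestrictShift` provides exactly this SHIFTED base change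
(`exists_zpExtension_shift`: `2^a κ_M = κ ∘ res`, cyclotomic, `κ_M.layer n ≃+* j(M)·ℚ_{n+a}`), and the finite-level proof of the quadratic
step is about the fields `A_m = j(K)·ℚ_m ⊆ B_m = j'(K')·ℚ_m ⊆ ℚ̄` only.  Running it for EVERY `m` (where `[B_m : A_m] ∈ {1, 2}`) and reading
the shifted towers of `K` and `K'` off these fields removes the proviso:

* §1 `padicValNat_card_quotient_le_of_quadratic` — the per-field `2`-rank bound (pure number fields, extracted from
  `classicalMuVanishes_restrict_of_quadratic_of_signVec_surjective`): `A ⊆ B`, `[B : A] = 2`, `B` totally complex, unit signatures of `A`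
  onto, `≤ T` ramified primes ⟹ `rank₂ Cl(B) ≤ 2·(2·rank₂ Cl(A) + T)`.
* §2 `classGroupPRank_eq_of_layerSubgroup_eq` — `rank_p Cl(M_n) = rank_p Cl(j(M)·F_m)` for any `ℤ_p`-extension of `M` whose `n`-th layer
  subgroup is `res⁻¹` of `κ`'s `m`-th (shift: `m = n + a`).
* §3 `padicValNat_card_quotient_fieldRange_sup_layer_le` — the per-layer bound for `A_m ⊆ B_m` with `K' = K(x)`, `x² = m₀ ∈ 𝓞_K ∖ 0`,
  `K'` totally complex, `K` with at most one real embedding: `rank₂ Cl(B_m) ≤ 2·(2·rank₂ Cl(A_m) + T)`, `T = ∑_{ℓ ∣ N(4m₀)} [K:ℚ]·ℓ²`,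
  for EVERY `m` (no surjectivity anywhere).
The assembled quadratic step (★★★ `classicalMu_of_finrank_eq_two_of_subsingleton_realEmbedding`: «`ClassicalMuVanishes` for every cyclotomic
`ℤ₂`-extension of `K`» ⟹ «the same for `K'`», no proviso), the `2`-power Galois ascent and Iwasawa 1973 §4 for EVERY Galois `2`-power
extension of `ℚ` are the sequel file `ClassicalMuVanishesTwoPowerGaloisRatFull`.

References: [Iwasawa1973MuInvariants] Thm. 2, Thm. 3 («`k` totally imaginary if `l = 2`»), §3–§4; [Washington1997] §13.1 (layers `M·ℚ_{n+a}`),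
§13.3 Prop. 13.23; [Lang1990] Ch. 13 §4 Lemma 4.1; [NeukirchANT1999] Ch. III (2.6), Ch. I §8.
-/

set_option autoImplicit false

noncomputable section

open scoped NumberField Classical
open NumberField Field IntermediateField IsDedekindDomain Module Polynomial

namespace Literature.NumberTheory.IwasawaTheory

open Literature.NumberTheory.EllipticCurves Literature.NumberTheory.EllipticCurves.ZpExtension
  Literature.NumberTheory.GaloisRepresentations Literature.NumberTheory.NumberFields
  Literature.NumberTheory.NumberFields.AmbiguousClass Literature.NumberTheory.NumberFields.CyclicRankBound
  Literature.NumberTheory.NumberFields.UnitSignature Literature.Geometry.Kaehler.ComplexTorus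

/-! ## §1 The per-field `2`-rank bound along a quadratic extension -/

/-- `#(G / Gⁿ) = #(H / Hⁿ)` along a group isomorphism `G ≃* H`. [folklore] -/
private theorem natCard_quotient_range_powMonoidHom_eq_of_mulEquiv {G H : Type*} [CommGroup G] [CommGroup H] (e : G ≃* H) (n : ℕ) :
    Nat.card (G ⧸ (powMonoidHom n : G →* G).range) = Nat.card (H ⧸ (powMonoidHom n : H →* H).range) := by
  have hmap : ((powMonoidHom n : G →* G).range).map e.toMonoidHom = (powMonoidHom n : H →* H).range := by
    ext h
    constructor
    · rintro ⟨g, ⟨x, rfl⟩, rfl⟩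
      exact ⟨e x, by rw [powMonoidHom_apply, powMonoidHom_apply, MulEquiv.coe_toMonoidHom, map_pow]⟩
    · rintro ⟨y, rfl⟩
      refine ⟨(e.symm y) ^ n, ⟨e.symm y, rfl⟩, ?_⟩
      rw [MulEquiv.coe_toMonoidHom, map_pow, MulEquiv.apply_symm_apply, powMonoidHom_apply]
  exact Nat.card_congr (QuotientGroup.congr _ _ e hmap).toEquiv

/-- **The `2`-rank bound along a quadratic extension of number fields** (Chevalley + the ambiguous-class rank lemma): `A ⊆ B`, `[B : A] = 2`,
`B` totally complex, the unit signature map of `A` onto, at most `T` primes of `A` ramified in `B` ⟹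
`rank₂ Cl(B) ≤ 2·(2·rank₂ Cl(A) + T)` (`rank₂ X = ord₂ #(X/X²)`).  Modules (L) `padicValNat_two_card_fixed_add_one_le_of_signVec_surjective` and
(G) `padicValNat_card_quotient_le_of_fixed` of cell bsd-2adic, assembled exactly as inside `classicalMuVanishes_restrict_of_quadratic_of_signVec_surjective`.
[cite: Iwasawa1973MuInvariants, Thm. 2 and Thm. 3 (structure of the argument)] [cite: Lang1990, Ch. 13 §4 Lemma 4.1] [cite: Washington1997, §13.3 Prop. 13.23] -/
theorem padicValNat_card_quotient_le_of_quadratic (A B : Type) [Field A] [NumberField A] [Field B] [NumberField B] [Algebra A B]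
    [IsTotallyComplex B] (hdeg : Module.finrank A B = 2) (hsig : Function.Surjective (signVec (K := A))) (T : ℕ)
    (hram : {v : HeightOneSpectrum (𝓞 A) | v.asIdeal.ramificationIdxIn (𝓞 B) ≠ 1}.ncard ≤ T) :
    padicValNat 2 (Nat.card (ClassGroup (𝓞 B) ⧸ (powMonoidHom 2 : ClassGroup (𝓞 B) →* _).range)) ≤
      2 * (2 * padicValNat 2 (Nat.card (ClassGroup (𝓞 A) ⧸ (powMonoidHom 2 : ClassGroup (𝓞 A) →* _).range)) + T) := by
  haveI : Fact (Nat.Prime 2) := ⟨Nat.prime_two⟩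
  haveI : Algebra.IsQuadraticExtension A B := ⟨hdeg⟩
  haveI : IsGalois A B := inferInstance
  haveI : FiniteDimensional A B := Module.finite_of_finrank_eq_succ hdeg
  -- a generator of `Gal(B/A) ≅ C₂`
  obtain ⟨σ, hσ⟩ := IsCyclic.exists_generator (α := B ≃ₐ[A] B)
  have hcard : Fintype.card (B ≃ₐ[A] B) = 2 := by
    rw [← Nat.card_eq_fintype_card, IsGalois.card_aut_eq_finrank, hdeg]
  have hσ2 : σ * σ = 1 := by rw [← pow_two, ← hcard, pow_card_eq_one]
  -- module (L): Chevalley as a `2`-adic inequality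
  have hchev := padicValNat_two_card_fixed_add_one_le_of_signVec_surjective (K := A) (L := B) hdeg hsig hσ
  -- the action on `Cl(B)` and its fixed classes
  set f : ClassGroup (𝓞 B) ≃* ClassGroup (𝓞 B) := ClassGroup.mulEquiv (intAut σ) with hf
  have hfixed : Nat.card {c : ClassGroup (𝓞 B) // ∀ τ : B ≃ₐ[A] B, ClassGroup.mulEquiv (intAut τ) c = c} =
      Nat.card (f.toMonoidHom.eqLocus (MonoidHom.id _)) :=
    natCard_fixed_eq_natCard_eqLocus_of_generator (fun τ : B ≃ₐ[A] B ↦ ClassGroup.mulEquiv (intAut τ))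
      mulEquiv_intAut_one mulEquiv_intAut_mul hσ
  have hff : ∀ b : ClassGroup (𝓞 B), (⇑f.toMonoidHom)^[2] b = b := fun b ↦ by
    rw [Function.iterate_succ_apply, Function.iterate_one, MulEquiv.coe_toMonoidHom, hf, ← MulEquiv.trans_apply,
      ← mulEquiv_intAut_mul, hσ2, mulEquiv_intAut_one, MulEquiv.refl_apply]
  -- module (G): the rank bound
  have hNj : ∀ a : ClassGroup (𝓞 A), classGroupNorm A B (classGroupExtend A B a) = a ^ 2 := fun a ↦ by
    rw [classGroupNorm_classGroupExtend, hdeg]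
  have hjfix : ∀ a : ClassGroup (𝓞 A), f.toMonoidHom (classGroupExtend A B a) = classGroupExtend A B a := fun a ↦ by
    rw [MulEquiv.coe_toMonoidHom, hf, mulEquiv_intAut_classGroupExtend]
  have hfix : padicValNat 2 (Nat.card (f.toMonoidHom.eqLocus (MonoidHom.id _))) ≤
      padicValNat 2 (Nat.card (ClassGroup (𝓞 A))) + T := by
    rw [← hfixed]
    have hcl : classNumber A = Nat.card (ClassGroup (𝓞 A)) := by
      rw [classNumber, Nat.card_eq_fintype_card]
    rw [← hcl]
    omega
  exact padicValNat_card_quotient_le_of_fixed 2 f.toMonoidHom hff (classGroupExtend A B) (classGroupNorm A B) hNj hjfix T hfix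

/-! ## §2 The `p`-rank of a layer of a shifted tower -/

/-- **`rank_p Cl(M_n) = rank_p Cl(j(M)·F_m)`** for a `ℤ_p`-extension `κ'` of `M` with `Gal(M̄/M_n) = res⁻¹ Gal(F̄/F_m)` (`κ` a `ℤ_p`-extension of
`F`, `M/F` finite, `j : M → F̄`; the shifted base change has `m = n + a`): class groups along the ring isomorphism
`nonempty_ringEquiv_layer_fieldRange_sup_layer_of_layerSubgroup_eq`. [cite: Washington1997, §13.1 (the layers M·F_{n+a})] -/
theorem classGroupPRank_eq_of_layerSubgroup_eq {F : Type} [Field F] [NumberField F] {p : ℕ} [Fact p.Prime] (κ : ZpExtension F p)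
    (M : Type) [Field M] [NumberField M] [Algebra F M] (κ' : ZpExtension M p) {n m : ℕ}
    (hnm : κ'.layerSubgroup n = (κ.layerSubgroup m).comap (absGaloisRestrict F M).toMonoidHom)
    (j : M →ₐ[F] AlgebraicClosure F) :
    classGroupPRank κ' n =
      padicValNat p (Nat.card (ClassGroup (𝓞 ↥(j.fieldRange ⊔ κ.layer m)) ⧸
        (powMonoidHom p : ClassGroup (𝓞 ↥(j.fieldRange ⊔ κ.layer m)) →* _).range)) := by
  obtain ⟨e⟩ := nonempty_ringEquiv_layer_fieldRange_sup_layer_of_layerSubgroup_eq κ M κ' hnm j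
  rw [classGroupPRank_def,
    natCard_quotient_range_powMonoidHom_eq_of_mulEquiv (ClassGroup.mulEquiv (NumberField.RingOfIntegers.mapRingEquiv e)) p]

/-! ## §3 The per-layer bound for `A_m = j(K)·ℚ_m ⊆ B_m = j'(K')·ℚ_m`, every `m` -/

/-- An integral element of `K'` gives an integral element of a subfield of `ℚ̄` containing its image. [folklore] -/
private theorem isIntegral_mk_of_isIntegral' {L : IntermediateField ℚ (AlgebraicClosure ℚ)} {y : AlgebraicClosure ℚ} (hy : y ∈ L)
    (hint : IsIntegral ℤ y) : IsIntegral ℤ (⟨y, hy⟩ : ↥L) :=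
  (isIntegral_algHom_iff (IsScalarTower.toAlgHom ℤ ↥L (AlgebraicClosure ℚ)) Subtype.val_injective).mp hint

variable (κ : ZpExtension ℚ 2)

set_option maxHeartbeats 800000 in
set_option synthInstance.maxHeartbeats 200000 in
/-- **The per-layer `2`-rank bound, no surjectivity anywhere.** `κ` the cyclotomic `ℤ₂`-extension of `ℚ` (layers `ℚ_m`); `K ⊆ K'` number fields
with `K' = K(x)`, `x ∈ 𝓞_{K'}`, `x² = m₀ ∈ 𝓞_K ∖ 0` (so `[K' : K] ≤ 2`), `K'` totally complex, `K` with at most one real embedding; `j' : K' → ℚ̄`,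
`j = j'|_K`, `A_m = j(K)·ℚ_m ⊆ B_m = j'(K')·ℚ_m`.  Then for EVERY `m`:
`rank₂ Cl(B_m) ≤ 2·(2·rank₂ Cl(A_m) + T)`, `T = ∑_{ℓ ∣ N(4m₀)} [K:ℚ]·ℓ²`.  `B_m = A_m(j'x)` has degree `1` or `2` over `A_m`; degree `1`:
`B_m = A_m`; degree `2`: §1 with the unit signatures of `ℚ_m` (`signVec_surjective_fieldRange_sup_layer`) and the ramified primes above the prime
factors of `N(4m₀)`, at most `[A_m : ℚ_m]·ℓ² ≤ [K:ℚ]·ℓ²` over each `ℓ` (`ncard_primesOver_layer_two_le_sq`).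
[cite: Iwasawa1973MuInvariants, Thm. 2 and Thm. 3] [cite: Washington1997, §13.1 and §13.3 Prop. 13.23] [cite: NeukirchANT1999, Ch. III (2.6)] -/
theorem padicValNat_card_quotient_fieldRange_sup_layer_le (hκ : κ.IsCyclotomic)
    (K K' : Type) [Field K] [NumberField K] [Field K'] [NumberField K'] [Algebra K K'] [IsTotallyComplex K']
    [Subsingleton (K →+* ℝ)]
    {x : 𝓞 K'} {m₀ : 𝓞 K} (hm : m₀ ≠ 0) (hx : x ^ 2 = algebraMap (𝓞 K) (𝓞 K') m₀) (hgen : Algebra.adjoin K {(x : K')} = ⊤)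
    (j' : K' →ₐ[ℚ] AlgebraicClosure ℚ) (m : ℕ) :
    haveI : IsScalarTower ℚ K K' := IsScalarTower.of_algebraMap_eq' (Subsingleton.elim _ _)
    padicValNat 2 (Nat.card (ClassGroup (𝓞 ↥(j'.fieldRange ⊔ κ.layer m)) ⧸
        (powMonoidHom 2 : ClassGroup (𝓞 ↥(j'.fieldRange ⊔ κ.layer m)) →* _).range)) ≤
      2 * (2 * padicValNat 2 (Nat.card (ClassGroup (𝓞 ↥((j'.comp (IsScalarTower.toAlgHom ℚ K K')).fieldRange ⊔ κ.layer m)) ⧸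
        (powMonoidHom 2 : ClassGroup (𝓞 ↥((j'.comp (IsScalarTower.toAlgHom ℚ K K')).fieldRange ⊔ κ.layer m)) →* _).range)) +
        ∑ ℓ ∈ ((Ideal.absNorm (Ideal.span {(4 * m₀ : 𝓞 K)}) : ℤ)).natAbs.primeFactors, Module.finrank ℚ K * ℓ ^ 2) := by
  haveI : Fact (Nat.Prime 2) := ⟨Nat.prime_two⟩
  haveI : IsScalarTower ℚ K K' := IsScalarTower.of_algebraMap_eq' (Subsingleton.elim _ _)
  haveI : FiniteDimensional K K' := Module.Finite.of_restrictScalars_finite ℚ K K'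
  set j : K →ₐ[ℚ] AlgebraicClosure ℚ := j'.comp (IsScalarTower.toAlgHom ℚ K K') with hj
  -- the integer `N₀ = N(4m₀)` whose prime factors control the ramified primes of every layer
  set N₀ : ℕ := Ideal.absNorm (Ideal.span {(4 * m₀ : 𝓞 K)}) with hN₀
  have h4m0 : (4 * m₀ : 𝓞 K) ≠ 0 := mul_ne_zero (by norm_num) hm
  have hN₀0 : (N₀ : ℤ) ≠ 0 := by
    rw [hN₀]
    exact_mod_cast (Ideal.absNorm_eq_zero_iff.not.mpr (mt Ideal.span_singleton_eq_bot.mp h4m0))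
  have hdvdK : (4 * m₀ : 𝓞 K) ∣ ((N₀ : ℤ) : 𝓞 K) := by
    rw [← Ideal.mem_span_singleton]
    have h := Ideal.absNorm_mem (Ideal.span {(4 * m₀ : 𝓞 K)})
    rw [← hN₀] at h
    exact_mod_cast h
  set T : ℕ := ∑ ℓ ∈ (N₀ : ℤ).natAbs.primeFactors, Module.finrank ℚ K * ℓ ^ 2 with hT
  -- the layer `A = j(K)·ℚ_m ⊆ B = j'(K')·ℚ_m`
  set L : IntermediateField ℚ (AlgebraicClosure ℚ) := κ.layer m with hL
  set A : IntermediateField ℚ (AlgebraicClosure ℚ) := j.fieldRange ⊔ L with hA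
  set B : IntermediateField ℚ (AlgebraicClosure ℚ) := j'.fieldRange ⊔ L with hB
  have hAB : A ≤ B := fieldRange_comp_sup_layer_le κ K K' j' m
  haveI : NumberField ↥A := numberField_fieldRange_sup_layer κ K j m
  haveI : NumberField ↥B := numberField_fieldRange_sup_layer κ K' j' m
  letI : Algebra ↥A ↥B := (IntermediateField.inclusion hAB).toRingHom.toAlgebra
  haveI : IsScalarTower ℚ ↥A ↥B := IsScalarTower.of_algebraMap_eq fun _ ↦ rfl
  haveI : Module.Free ↥A ↥B := Module.Free.of_divisionRing ↥A ↥B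
  haveI : FiniteDimensional ↥A ↥B := Module.Finite.of_restrictScalars_finite ℚ ↥A ↥B
  haveI : FiniteDimensional ℚ ↥L := κ.finiteDimensional_layer_holds m
  haveI : NumberField ↥L := NumberField.of_module_finite ℚ _
  haveI : FiniteDimensional ℚ ↥j.fieldRange := (AlgEquiv.ofInjectiveField j).toLinearEquiv.finiteDimensional
  -- `B` is totally complex (it contains a copy of `K'`)
  haveI : IsTotallyComplex ↥B := by
    letI : Algebra K' ↥B :=
      ((IntermediateField.inclusion (le_sup_left : j'.fieldRange ≤ B)).comp
        (AlgEquiv.ofInjectiveField j').toAlgHom).toRingHom.toAlgebra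
    exact isTotallyComplex_of_algebra (F := K') ↥B
  -- the generator in the layer: `x_B² = m_A`, `B = A(x_B)`
  have hjA : j.fieldRange ≤ A := le_sup_left
  have hj'B : j'.fieldRange ≤ B := le_sup_left
  have hLA : L ≤ A := le_sup_right
  have hmA : (j ((m₀ : 𝓞 K) : K)) ∈ A := hjA ⟨(m₀ : K), rfl⟩
  have hxB : (j' ((x : 𝓞 K') : K')) ∈ B := hj'B ⟨(x : K'), rfl⟩
  let mA : 𝓞 ↥A := ⟨⟨j ((m₀ : 𝓞 K) : K), hmA⟩, isIntegral_mk_of_isIntegral' hmA (map_isIntegral_int j m₀.isIntegral_coe)⟩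
  let xB : 𝓞 ↥B := ⟨⟨j' ((x : 𝓞 K') : K'), hxB⟩, isIntegral_mk_of_isIntegral' hxB (map_isIntegral_int j' x.isIntegral_coe)⟩
  have hjm : j ((m₀ : 𝓞 K) : K) = j' (algebraMap K K' ((m₀ : 𝓞 K) : K)) := rfl
  have hx' : ((x : 𝓞 K') : K') ^ 2 = algebraMap K K' ((m₀ : 𝓞 K) : K) := by
    have h := congrArg (fun z : 𝓞 K' ↦ (z : K')) hx
    have e1 : (((x ^ 2 : 𝓞 K') : 𝓞 K') : K') = ((x : 𝓞 K') : K') ^ 2 := by push_cast; rfl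
    have e2 : (((algebraMap (𝓞 K) (𝓞 K') m₀ : 𝓞 K') : 𝓞 K') : K') = algebraMap K K' ((m₀ : 𝓞 K) : K) := rfl
    rw [← e1, ← e2]
    exact h
  have hxB2 : xB ^ 2 = algebraMap (𝓞 ↥A) (𝓞 ↥B) mA := by
    apply RingOfIntegers.ext
    apply Subtype.ext
    change (j' ((x : 𝓞 K') : K')) ^ 2 = j ((m₀ : 𝓞 K) : K)
    rw [← map_pow, hx', hjm]
  have hxB2' : ((xB : 𝓞 ↥B) : ↥B) ^ 2 = algebraMap ↥A ↥B ((mA : 𝓞 ↥A) : ↥A) := by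
    apply Subtype.ext
    change (j' ((x : 𝓞 K') : K')) ^ 2 = j ((m₀ : 𝓞 K) : K)
    rw [← map_pow, hx', hjm]
  -- `B = A(x_B)`
  have hgenB : Algebra.adjoin ↥A {((xB : 𝓞 ↥B) : ↥B)} = ⊤ := by
    set Tad : Subalgebra ↥A ↥B := Algebra.adjoin ↥A {((xB : 𝓞 ↥B) : ↥B)} with hTad
    -- the elements of `ℚ̄` lying in `B` whose class is in `Tad`
    let S : Subalgebra ℚ (AlgebraicClosure ℚ) :=
      { carrier := {y | ∃ hy : y ∈ B, (⟨y, hy⟩ : ↥B) ∈ Tad}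
        mul_mem' := by
          rintro a b ⟨ha, ha'⟩ ⟨hb, hb'⟩
          exact ⟨mul_mem ha hb, by
            have e : (⟨a * b, mul_mem ha hb⟩ : ↥B) = ⟨a, ha⟩ * ⟨b, hb⟩ := rfl
            rw [e]; exact Tad.mul_mem ha' hb'⟩
        one_mem' := ⟨one_mem _, by
          have e : (⟨1, one_mem _⟩ : ↥B) = 1 := rfl
          rw [e]; exact Tad.one_mem⟩
        add_mem' := by
          rintro a b ⟨ha, ha'⟩ ⟨hb, hb'⟩
          exact ⟨add_mem ha hb, by
            have e : (⟨a + b, add_mem ha hb⟩ : ↥B) = ⟨a, ha⟩ + ⟨b, hb⟩ := rfl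
            rw [e]; exact Tad.add_mem ha' hb'⟩
        zero_mem' := ⟨zero_mem _, by
          have e : (⟨0, zero_mem _⟩ : ↥B) = 0 := rfl
          rw [e]; exact Tad.zero_mem⟩
        algebraMap_mem' := fun r ↦ ⟨IntermediateField.algebraMap_mem B r, Tad.algebraMap_mem (algebraMap ℚ ↥A r)⟩ }
    -- `A ⊆ S`
    have hAS : ∀ y (hy : y ∈ A), y ∈ S := fun y hy ↦ ⟨hAB hy, by
      have e : (⟨y, hAB hy⟩ : ↥B) = algebraMap ↥A ↥B ⟨y, hy⟩ := rfl
      rw [e]; exact Tad.algebraMap_mem _⟩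
    -- `j'(K') ⊆ S`: every element of `K'` is a polynomial in `x` over `K`
    have hK'S : j'.fieldRange.toSubalgebra ≤ S := by
      rintro _ ⟨y, rfl⟩
      have hy : (y : K') ∈ Algebra.adjoin K {((x : 𝓞 K') : K')} := by rw [hgen]; exact Algebra.mem_top
      induction hy using Algebra.adjoin_induction with
      | mem z hz =>
        rw [Set.mem_singleton_iff] at hz
        subst hz
        exact ⟨hxB, Algebra.subset_adjoin (Set.mem_singleton _)⟩
      | algebraMap r =>
        have : j' (algebraMap K K' r) = j r := rfl
        rw [AlgHom.toRingHom_eq_coe, RingHom.coe_coe, this]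
        exact hAS _ (hjA ⟨r, rfl⟩)
      | add a b _ _ ha hb =>
        rw [AlgHom.toRingHom_eq_coe, RingHom.coe_coe, map_add]
        exact S.add_mem ha hb
      | mul a b _ _ ha hb =>
        rw [AlgHom.toRingHom_eq_coe, RingHom.coe_coe, map_mul]
        exact S.mul_mem ha hb
    have hLS : L.toSubalgebra ≤ S := fun y hy ↦ hAS y (hLA hy)
    have hBS : B.toSubalgebra ≤ S := by
      haveI : Algebra.IsAlgebraic ℚ ↥L := Algebra.IsAlgebraic.of_finite ℚ ↥L
      rw [hB, IntermediateField.sup_toSubalgebra_of_isAlgebraic_right]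
      exact sup_le hK'S hLS
    rw [eq_top_iff]
    rintro ⟨y, hy⟩ -
    obtain ⟨hy', h⟩ := hBS hy
    exact h
  -- hence `[B : A] ≤ 2`
  have hxint : IsIntegral ↥A ((xB : 𝓞 ↥B) : ↥B) := IsIntegral.of_finite _ _
  have hdegle : Module.finrank ↥A ↥B ≤ 2 := by
    have h1 : Module.finrank ↥A ↥(↥A)⟮((xB : 𝓞 ↥B) : ↥B)⟯ = (minpoly ↥A ((xB : 𝓞 ↥B) : ↥B)).natDegree :=
      IntermediateField.adjoin.finrank hxint
    have htop : (↥A)⟮((xB : 𝓞 ↥B) : ↥B)⟯ = ⊤ := by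
      apply IntermediateField.toSubalgebra_injective
      rw [IntermediateField.adjoin_simple_toSubalgebra_of_isAlgebraic hxint.isAlgebraic, hgenB, IntermediateField.top_toSubalgebra]
    have hne : (X ^ 2 - C ((mA : 𝓞 ↥A) : ↥A) : (↥A)[X]) ≠ 0 := (monic_X_pow_sub_C _ two_ne_zero).ne_zero
    have hroot : aeval ((xB : 𝓞 ↥B) : ↥B) (X ^ 2 - C ((mA : 𝓞 ↥A) : ↥A) : (↥A)[X]) = 0 := by
      rw [map_sub, aeval_X_pow, aeval_C, hxB2', sub_self]
    have h2 : (minpoly ↥A ((xB : 𝓞 ↥B) : ↥B)).natDegree ≤ 2 := by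
      calc (minpoly ↥A ((xB : 𝓞 ↥B) : ↥B)).natDegree ≤ (X ^ 2 - C ((mA : 𝓞 ↥A) : ↥A) : (↥A)[X]).natDegree :=
            natDegree_le_of_dvd (minpoly.dvd _ _ hroot) hne
        _ = 2 := natDegree_X_pow_sub_C
    rw [← IntermediateField.finrank_top', ← htop, h1]
    exact h2
  have hdegpos : 0 < Module.finrank ↥A ↥B := Module.finrank_pos
  -- abbreviations for the two ranks
  set rA : ℕ := padicValNat 2 (Nat.card (ClassGroup (𝓞 ↥A) ⧸ (powMonoidHom 2 : ClassGroup (𝓞 ↥A) →* _).range)) with hrA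
  set rB : ℕ := padicValNat 2 (Nat.card (ClassGroup (𝓞 ↥B) ⧸ (powMonoidHom 2 : ClassGroup (𝓞 ↥B) →* _).range)) with hrB
  change rB ≤ 2 * (2 * rA + T)
  rcases Nat.lt_or_ge (Module.finrank ↥A ↥B) 2 with hlt | hge
  · -- degree `1`: `B = A`
    have hdeg1 : Module.finrank ↥A ↥B = 1 := by omega
    have hfin : Module.finrank ℚ ↥A = Module.finrank ℚ ↥B := by
      have htower := Module.finrank_mul_finrank ℚ ↥A ↥B
      rw [hdeg1, mul_one] at htower
      exact htower
    have hEq : A = B := IntermediateField.eq_of_le_of_finrank_eq hAB hfin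
    have hrAB : rA = rB := by
      rw [hrA, hrB]
      exact congrArg (padicValNat 2) (natCard_quotient_range_powMonoidHom_eq_of_mulEquiv
        (ClassGroup.mulEquiv (NumberField.RingOfIntegers.mapRingEquiv (IntermediateField.equivOfEq hEq).toRingEquiv)) 2)
    omega
  · -- degree `2`: Chevalley
    have hdegAB : Module.finrank ↥A ↥B = 2 := le_antisymm hdegle hge
    haveI : Algebra.IsQuadraticExtension ↥A ↥B := ⟨hdegAB⟩
    haveI : IsGalois ↥A ↥B := inferInstance
    -- signatures of `A = j(K)·ℚ_m`
    have hsig : Function.Surjective (signVec (K := ↥A)) := signVec_surjective_fieldRange_sup_layer κ hκ K j m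
    -- count: ramified primes contain `4 m_A`, which divides `N₀`
    have hmA0 : mA ≠ 0 := by
      intro h0
      apply hm
      have h1 : ((mA : 𝓞 ↥A) : ↥A) = 0 := by rw [h0]; rfl
      have h2 : j ((m₀ : 𝓞 K) : K) = 0 := by
        have := congrArg Subtype.val h1
        rwa [ZeroMemClass.coe_zero] at this
      rw [map_eq_zero_iff j j.injective] at h2
      exact RingOfIntegers.ext (by simpa using h2)
    let ψ : 𝓞 K →+* 𝓞 ↥A :=
      { toFun := fun k ↦ ⟨⟨j ((k : 𝓞 K) : K), hjA ⟨(k : K), rfl⟩⟩,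
          isIntegral_mk_of_isIntegral' _ (map_isIntegral_int j k.isIntegral_coe)⟩
        map_one' := by apply RingOfIntegers.ext; apply Subtype.ext; simp
        map_mul' := fun a b ↦ by apply RingOfIntegers.ext; apply Subtype.ext; simp
        map_zero' := by apply RingOfIntegers.ext; apply Subtype.ext; simp
        map_add' := fun a b ↦ by apply RingOfIntegers.ext; apply Subtype.ext; simp }
    have hψm : ψ m₀ = mA := rfl
    have hdvdA : (4 * mA : 𝓞 ↥A) ∣ (((N₀ : ℤ) : 𝓞 ↥A)) := by
      have h := map_dvd ψ hdvdK
      rw [map_mul, hψm, map_intCast] at h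
      have e4 : ψ 4 = 4 := by rw [show (4 : 𝓞 K) = ((4 : ℤ) : 𝓞 K) by norm_cast, map_intCast]; norm_cast
      rwa [e4] at h
    have hram1 := ncard_ramified_le_ncard_mem hxB2 hgenB hmA0
    have hram2 := ncard_setOf_mem_le_sum_primesOver (F := ↥A) hN₀0 hdvdA
    -- primes of `A` over `ℓ`: at most `[A : ℚ_m]·ℓ² ≤ [K : ℚ]·ℓ²`
    letI : Algebra ↥L ↥A := (IntermediateField.inclusion hLA).toRingHom.toAlgebra
    haveI : IsScalarTower ℚ ↥L ↥A := IsScalarTower.of_algebraMap_eq fun _ ↦ rfl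
    haveI : Module.Free ↥L ↥A := Module.Free.of_divisionRing ↥L ↥A
    haveI : FiniteDimensional ↥L ↥A := Module.Finite.of_restrictScalars_finite ℚ ↥L ↥A
    have hdegLA : Module.finrank ↥L ↥A ≤ Module.finrank ℚ K := by
      have htower := Module.finrank_mul_finrank ℚ ↥L ↥A
      have hsup : Module.finrank ℚ ↥A ≤ Module.finrank ℚ ↥j.fieldRange * Module.finrank ℚ ↥L :=
        IntermediateField.finrank_sup_le j.fieldRange L
      have hjK : Module.finrank ℚ ↥j.fieldRange = Module.finrank ℚ K :=
        (AlgEquiv.ofInjectiveField j).toLinearEquiv.finrank_eq.symm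
      have hLpos : 0 < Module.finrank ℚ ↥L := Module.finrank_pos
      rw [hjK, ← htower, mul_comm (Module.finrank ℚ K)] at hsup
      exact Nat.le_of_mul_le_mul_left hsup hLpos
    have hfib : ∀ ℓ ∈ (N₀ : ℤ).natAbs.primeFactors,
        ((Ideal.span {(ℓ : ℤ)}).primesOver (𝓞 ↥A)).ncard ≤ Module.finrank ℚ K * ℓ ^ 2 := fun ℓ hℓ ↦ by
      have hℓp : ℓ.Prime := Nat.prime_of_mem_primeFactors hℓ
      refine (ncard_primesOver_le_finrank_mul ↥L ↥A hℓp).trans ?_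
      exact Nat.mul_le_mul hdegLA (ncard_primesOver_layer_two_le_sq hκ m hℓp)
    have hramT : {v : HeightOneSpectrum (𝓞 ↥A) | v.asIdeal.ramificationIdxIn (𝓞 ↥B) ≠ 1}.ncard ≤ T :=
      calc {v : HeightOneSpectrum (𝓞 ↥A) | v.asIdeal.ramificationIdxIn (𝓞 ↥B) ≠ 1}.ncard
          ≤ {v : HeightOneSpectrum (𝓞 ↥A) | 4 * mA ∈ v.asIdeal}.ncard := hram1
        _ ≤ ∑ ℓ ∈ (N₀ : ℤ).natAbs.primeFactors, ((Ideal.span {(ℓ : ℤ)}).primesOver (𝓞 ↥A)).ncard := hram2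
        _ ≤ T := Finset.sum_le_sum hfib
    exact padicValNat_card_quotient_le_of_quadratic ↥A ↥B hdegAB hsig T hramT

end Literature.NumberTheory.IwasawaTheory

end
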